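import Mathlib
import Summits.Ventures.PercRepro2.Defs
import Summits.Ventures.PercRepro2.Graph
import Summits.Ventures.PercRepro2.OneColourSwitch
import Summits.Ventures.PercRepro2.RegionHubSign
import Summits.Ventures.PercRepro2.SideSwitch
import Summits.Ventures.PercRepro2.SideSwitchFibre
import Summits.Ventures.PercRepro2.SideSwitchClosed
import Summits.Ventures.PercRepro2.SideSwitchComps
import Summits.Ventures.PercRepro2.SideSwitchCompsFibre
import Summits.Ventures.PercRepro2.M9NoPocketDefs
import Summits.Ventures.PercRepro2.M9NoPocketWorld
import Summits.Ventures.PercRepro2.M9NoPocketWorldD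
import Summits.Ventures.PercRepro2.M9NoPocketCompl
import Summits.Ventures.PercRepro2.M9NoPocketM9
import Summits.Ventures.PercRepro2.M9DAvoid
import Summits.Ventures.PercRepro2.M9DAvoidSplit
import Summits.Ventures.PercRepro2.M9RegionSplit
import Summits.Ventures.PercRepro2.M9HarrisCube
import Summits.Ventures.PercRepro2.M9PocketCubeDefs
import Summits.Ventures.PercRepro2.M9PocketCubeFibre
import Summits.Ventures.PercRepro2.M9PocketCubeMono
import Summits.Ventures.PercRepro2.M9PocketCubeHub
import Summits.Ventures.PercRepro2.M9PocketCubeWorldMono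
import Summits.Ventures.PercRepro2.M9PocketCubeCompl
import Summits.Ventures.PercRepro2.M9PocketCubeHarrisY
import Summits.Ventures.PercRepro2.TermSwitchDefs
import Summits.Ventures.PercRepro2.TermSwitchReach
import Summits.Ventures.PercRepro2.M9Unreached
import Summits.Ventures.PercRepro2.M9GeneralDSplit
import Summits.Ventures.PercRepro2.M9GeneralDHD
import Summits.Ventures.PercRepro2.M9LinkedHD
import Summits.Ventures.PercRepro2.M9DeadEnd
import Summits.Ventures.PercRepro2.M9DeadEndMono
import Summits.Ventures.PercRepro2.M9DeadEndHarris
import Summits.Ventures.PercRepro2.M9LinkedHubCube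

/-!
# The hub–dead-end part of the `K`-side `Y_rs`-sum is non-positive (blind cell PercRepro2,
p3 g29, 2026-08-28; `proofs/P3-LINKED.md` §2 (L2), part 2)

The hub–dead-end region `regHD` of a pocket representative (the cube vectors whose assignment
is `HubDead`, `M9LinkedHubCube`) is a down-set, so the tilt lemma of `M9HarrisCube` with the cube
complement `cdualP` (applied to the indicator of the region composed with the complement, which
is monotone) gives `Σ_{regHD} σ̃_pq ≤ 0` (`regHD_sum_nonpos`); since `σ_pq = σ̃_pq − eW ≤ σ̃_pq`
on `K`-side colourings (`M9DAvoidSplit`), also `Σ_{regHD} σ_pq ≤ 0`, and the fibration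
`sum_dOne_eq_sum_repP_legalP` sums it to **`hubDeadSum ≤ 0`** (`hubDeadSum_nonpos`).  The
`K`-side `Y_rs`-sum `hdKYSum` of `M9LinkedHD` is `hubDeadSum + hdResid`, where the residual
`hdResid` collects the `K`-side `HD` colourings with `r ~_Y s` that are neither hubs nor block
dead ends — the colourings whose only defect is a pocket vertex in both clusters of `d`
(`hdKYSum_eq_hubDeadSum_add_hdResid`).  Hence **class C7 is reduced to `hdResid ≤ 0`**
(`dSignSum_nonpos_of_hdResid_nonpos`; P3-LINKED §3 (R5): the residual is rare and `≤ 0` in every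
instance checked, and is not a down-set of the cube).  Own work; std axioms.
-/

namespace Summit.Ventures.PercRepro2

namespace NoPocket

open Finset Classical RegionHub OneColourSwitch SideSwitch TermSwitch

variable {V : Type*} {E : Type*}

section Pointwise

variable {ends : E → Sym2 V} {p q r s d : V}

/-- `hubW` gives the `W`-defect of `M9GeneralDHD`. -/
lemma wDefect_of_hubW {ω : Config E} (h : hubW ends d p q ω) : WDefect ends p q r s d ω := by
  rcases conn_d_of_hubY h with hc | hc
  · exact Or.inl hc
  · exact Or.inr (Or.inl hc)

/-- A block dead end gives the `W`-defect of `M9GeneralDHD`. -/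
lemma wDefect_of_deadWb {ω : Config E} (hd : d ≠ r) (hs : d ≠ s) (h : deadWb ends d r s ω) :
    WDefect ends p q r s d ω := by
  obtain ⟨v, hvr, hvs, hvK, hc⟩ := h
  have hvd : v ≠ d := fun hvd => not_mem_K2_endsD hd hs ω (hvd ▸ hvK)
  refine Or.inr (Or.inr ⟨v, hvr, hvs, hvd, ?_, hc⟩)
  rcases mem_K2_iff.1 hvK with h1 | h1
  · exact mem_K2_iff.2 (Or.inl (conn_of_conn_endsD h1))
  · exact mem_K2_iff.2 (Or.inr (conn_of_conn_endsD h1))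

/-- On a hub–dead-end colouring `σ_pq ≤ σ̃_pq` (`σ_pq = σ̃_pq − eW` on the `K`-side,
`M9DAvoidSplit`). -/
lemma sigma_le_sigma_endsD_of_hubDead {p q r s d : V} {ω : Config E}
    (h : HubDead ends p q r s d ω) : sigma ends ω p q ≤ sigma (endsD ends d) ω p q := by
  obtain ⟨hsep, _, hK, hM, _, _⟩ := h
  rw [sigma_eq_endsD_add (d := d) hsep, if_pos hK, if_neg hM]
  have := eW_nonneg (ends := ends) (d := d) (p := p) (q := q) ω
  linarith

/-- A `K`-side `HD` colouring with `r ~_Y s` and a hub or block dead end is a hub–dead-end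
colouring, and conversely. -/
lemma hubDead_iff {p q r s d : V} (hr : d ≠ r) (hs : d ≠ s) {ω : Config E} :
    HubDead ends p q r s d ω ↔
      HD ends p q r s d ω ∧ d ∈ K2 ends r s ω ∧ Conn ends ω r s ∧
        (hubW ends d p q ω ∨ deadWb ends d r s ω) := by
  constructor
  · rintro ⟨hsep, hD, hK, _, hrs, hdef⟩
    refine ⟨⟨hsep, hD, Or.inl hK, ?_⟩, hK, hrs, hdef⟩
    rcases hdef with h | h
    · exact not_L_of_WDefect (wDefect_of_hubW h)
    · exact not_L_of_WDefect (wDefect_of_deadWb hr hs h)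
  · rintro ⟨h, hK, hrs, hdef⟩
    obtain ⟨_, hDZ, hone, -⟩ := hd_iff_dzero.1 h
    obtain ⟨hsep, hD, _, _⟩ := h
    have hM : d ∉ M2 ends r s ω := by
      rcases hone with ⟨_, hM⟩ | ⟨_, hK'⟩
      · exact hM
      · exact absurd hK hK'
    exact ⟨hsep, hD, hK, hM, hrs, hdef⟩

end Pointwise

section Sum

variable [Fintype V] [DecidableEq V] [Fintype E] [DecidableEq E]

variable (ends : E → Sym2 V)

/-- The hub–dead-end region of a representative: the cube vectors whose assignment is a
hub–dead-end colouring. -/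
noncomputable def regHD (p q r s d : V) (ρ : Config E) : Finset (Finset (Finset V) × Finset E) :=
  (cubeP ends d r s ρ).filter (fun x => HubDead ends p q r s d (assignX ends x ρ))

/-- **The hub–dead-end sum**: `Σ_{HubDead} σ_pq`. -/
noncomputable def hubDeadSum (p q r s d : V) : ℤ :=
  ∑ ω : Config E, if HubDead ends p q r s d ω then sigma ends ω p q else 0

/-- **The `¬disj` residual** of the `K`-side `Y_rs`-sum: the `K`-side `HD` colourings with
`r ~_Y s` that are neither hubs nor block dead ends. -/
noncomputable def hdResid (p q r s d : V) : ℤ :=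
  ∑ ω : Config E, if HD ends p q r s d ω ∧ d ∈ K2 ends r s ω ∧ Conn ends ω r s ∧
      ¬ (hubW ends d p q ω ∨ deadWb ends d r s ω) then sigma ends ω p q else 0

variable {ends}

/-- Membership in the hub–dead-end region. -/
lemma mem_regHD {p q r s d : V} {ρ : Config E} {x : Finset (Finset V) × Finset E} :
    x ∈ regHD ends p q r s d ρ ↔
      x ∈ cubeP ends d r s ρ ∧ HubDead ends p q r s d (assignX ends x ρ) := by
  simp [regHD]

/-- **Harris for the hub–dead-end region**: `Σ_{regHD} σ̃_pq ≤ 0` for every pocket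
representative (the tilt lemma with the indicator of the region composed with the cube
complement, which is monotone since the region is a down-set). -/
theorem regHD_sum_nonpos {p q r s d : V} (hr : d ≠ r) (hs : d ≠ s) (hpd : p ≠ d) (hqd : q ≠ d)
    {ρ : Config E} (hρ : ρ ∈ RepP ends p q r s d) :
    ∑ x ∈ regHD ends p q r s d ρ, sigma (endsD ends d) (assignX ends x ρ) p q ≤ 0 := by
  obtain ⟨hρD, _⟩ := mem_RepP.1 hρ
  set c : Finset (Finset V) × Finset E := (blocks ends d r s ρ, freeE ends d r s ρ) with hc
  have hcube : HarrisCube.cube c = cubeP ends d r s ρ := cube_eq_cubeP ρ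
  have hle : ∀ x, x ≤ c ↔ x ∈ cubeP ends d r s ρ := fun x => by
    rw [← HarrisCube.mem_cube, hcube]
  have hκc : ∀ x, x ≤ c → cdualP ends d r s ρ x ≤ c := fun x _ => (hle _).2 (cdualP_mem_cubeP ρ x)
  have hκκ : ∀ x, x ≤ c → cdualP ends d r s ρ (cdualP ends d r s ρ x) = x :=
    fun x hx => cdualP_cdualP ((hle x).1 hx)
  have key := HarrisCube.sum_sub_comp_mul_nonneg c (κ := cdualP ends d r s ρ) hκc hκκ
    (fun x _ y _ hxy => cdualP_antitone ρ hxy)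
    (f := yInd ends p q d ρ)
    (h := fun x => if cdualP ends d r s ρ x ∈ regHD ends p q r s d ρ then 1 else 0)
    (fun x _ => yInd_nonneg ρ x) (fun x _ => by split_ifs <;> norm_num)
    ?_ ?_
  · rw [hcube] at key
    have hre := HarrisCube.sum_comp_involution c (κ := cdualP ends d r s ρ) hκc hκκ
      (fun x => (yInd ends p q d ρ x - yInd ends p q d ρ (cdualP ends d r s ρ x)) *
        (if cdualP ends d r s ρ x ∈ regHD ends p q r s d ρ then 1 else 0))
    rw [hcube] at hre
    have hsimp : ∀ x ∈ cubeP ends d r s ρ,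
        (yInd ends p q d ρ (cdualP ends d r s ρ x) -
            yInd ends p q d ρ (cdualP ends d r s ρ (cdualP ends d r s ρ x))) *
          (if cdualP ends d r s ρ (cdualP ends d r s ρ x) ∈ regHD ends p q r s d ρ then 1
            else 0) =
        - ((yInd ends p q d ρ x - yInd ends p q d ρ (cdualP ends d r s ρ x)) *
          (if x ∈ regHD ends p q r s d ρ then 1 else 0)) := by
      intro x hx
      rw [cdualP_cdualP hx]
      ring
    rw [Finset.sum_congr rfl hsimp, Finset.sum_neg_distrib] at hre
    have h2 : ∑ x ∈ cubeP ends d r s ρ,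
        (yInd ends p q d ρ x - yInd ends p q d ρ (cdualP ends d r s ρ x)) *
          (if x ∈ regHD ends p q r s d ρ then 1 else 0) ≤ 0 := by linarith
    refine le_trans (le_of_eq ?_) h2
    rw [regHD, Finset.sum_filter]
    refine Finset.sum_congr rfl fun x hx => ?_
    rw [sigma_endsD_eq_sub_cdualP hr hs hρD hx]
    by_cases hP : HubDead ends p q r s d (assignX ends x ρ)
    · simp [Finset.mem_filter, hx, hP]
    · simp [Finset.mem_filter, hP]
  · -- `yInd` is monotone on the cube
    intro x hx y hy hxy
    have hx' := (hle x).1 hx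
    have hy' := (hle y).1 hy
    obtain ⟨hT, hF⟩ := mem_cubeP.1 hx'
    simp only [yInd]
    split_ifs with h1 h2
    · exact le_rfl
    · exfalso
      apply h2
      exact conn_endsD_assignX_mono hr hs hρ hxy hx' hy'
        (not_mem_K2_of_sep2 (sep2_endsD_assignX' hr hs hρD hT hF)).1 h1
    · norm_num
    · exact le_rfl
  · -- the indicator of the region composed with the complement is monotone
    intro x hx y hy hxy
    dsimp only
    split_ifs with h1 h2
    · exact le_rfl
    · exfalso
      apply h2
      exact mem_regHD.2 ⟨cdualP_mem_cubeP ρ y, hubDead_assignX_anti hr hs hpd hqd hρ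
        (cdualP_antitone ρ hxy) (cdualP_mem_cubeP ρ y) (cdualP_mem_cubeP ρ x)
        (mem_regHD.1 h1).2⟩
    · norm_num
    · exact le_rfl

/-- `Σ_{regHD} σ_pq ≤ 0` for every pocket representative. -/
theorem regHD_sigma_sum_nonpos {p q r s d : V} (hr : d ≠ r) (hs : d ≠ s) (hpd : p ≠ d)
    (hqd : q ≠ d) {ρ : Config E} (hρ : ρ ∈ RepP ends p q r s d) :
    ∑ x ∈ regHD ends p q r s d ρ, sigma ends (assignX ends x ρ) p q ≤ 0 :=
  le_trans (Finset.sum_le_sum fun _ hx => sigma_le_sigma_endsD_of_hubDead (mem_regHD.1 hx).2)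
    (regHD_sum_nonpos hr hs hpd hqd hρ)

/-- **The hub–dead-end sum is non-positive.** -/
theorem hubDeadSum_nonpos {p q r s d : V} (hr : d ≠ r) (hs : d ≠ s) (hpd : p ≠ d) (hqd : q ≠ d) :
    hubDeadSum ends p q r s d ≤ 0 := by
  have h1 : hubDeadSum ends p q r s d = ∑ ω ∈ DOneSet ends p q r s d,
      (if HubDead ends p q r s d ω then sigma ends ω p q else 0) := by
    unfold hubDeadSum DOneSet
    rw [Finset.sum_filter]
    refine Finset.sum_congr rfl fun ω _ => ?_
    by_cases h : sep2 ends p q r s ω ∧ DOne ends r s d ω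
    · simp [h]
    · have h' : ¬ HubDead ends p q r s d ω := fun h' => h ⟨h'.1, h'.2.1⟩
      simp [h, h']
  rw [h1, sum_dOne_eq_sum_repP_legalP hr hs]
  refine Finset.sum_nonpos fun ρ hρ => ?_
  have h2 : ∑ x ∈ LegalP ends p q r s d ρ,
      (if HubDead ends p q r s d (assignX ends x ρ) then sigma ends (assignX ends x ρ) p q
        else 0) = ∑ x ∈ regHD ends p q r s d ρ, sigma ends (assignX ends x ρ) p q := by
    rw [← Finset.sum_filter]
    refine Finset.sum_congr ?_ fun _ _ => rfl
    ext x
    simp only [Finset.mem_filter, mem_LegalP, mem_regHD, mem_DOneSet]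
    constructor
    · rintro ⟨⟨hc, _⟩, h⟩
      exact ⟨hc, h⟩
    · rintro ⟨hc, h⟩
      exact ⟨⟨hc, h.1, h.2.1⟩, h⟩
  rw [h2]
  exact regHD_sigma_sum_nonpos hr hs hpd hqd hρ

/-- **The `K`-side `Y_rs`-sum splits into the hub–dead-end sum and the `¬disj` residual.** -/
theorem hdKYSum_eq_hubDeadSum_add_hdResid {p q r s d : V} (hr : d ≠ r) (hs : d ≠ s) :
    hdKYSum ends p q r s d = hubDeadSum ends p q r s d + hdResid ends p q r s d := by
  unfold hdKYSum hubDeadSum hdResid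
  rw [← Finset.sum_add_distrib]
  refine Finset.sum_congr rfl fun ω _ => ?_
  by_cases h : HD ends p q r s d ω ∧ d ∈ K2 ends r s ω ∧ Conn ends ω r s
  · by_cases hdef : hubW ends d p q ω ∨ deadWb ends d r s ω
    · have h1 : HubDead ends p q r s d ω := (hubDead_iff hr hs).2 ⟨h.1, h.2.1, h.2.2, hdef⟩
      rw [if_pos h, if_pos h1, if_neg (fun h' => h'.2.2.2 hdef)]
      ring
    · have h1 : ¬ HubDead ends p q r s d ω := fun h' => hdef ((hubDead_iff hr hs).1 h').2.2.2
      rw [if_pos h, if_neg h1, if_pos ⟨h.1, h.2.1, h.2.2, hdef⟩]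
      ring
  · have h1 : ¬ HubDead ends p q r s d ω :=
      fun h' => h ⟨((hubDead_iff hr hs).1 h').1, ((hubDead_iff hr hs).1 h').2.1,
        ((hubDead_iff hr hs).1 h').2.2.1⟩
    rw [if_neg h, if_neg h1, if_neg (fun h' => h ⟨h'.1, h'.2.1, h'.2.2.1⟩)]
    ring

/-- **CLASS C7, reduced to the `¬disj` residual**: under the linked hypothesis the general
single-`d` statement follows from `hdResid ≤ 0`. -/
theorem dSignSum_nonpos_of_hdResid_nonpos {p q r s d : V} (hL : Linked ends r s d) (hr : r ≠ d)
    (hs : s ≠ d) (hpd : p ≠ d) (hqd : q ≠ d) (h : hdResid ends p q r s d ≤ 0) :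
    dSignSum ends p q r s d ≤ 0 := by
  refine dSignSum_nonpos_of_hdKYSum_nonpos hL hr hs ?_
  rw [hdKYSum_eq_hubDeadSum_add_hdResid hr.symm hs.symm]
  have := hubDeadSum_nonpos (ends := ends) (p := p) (q := q) hr.symm hs.symm hpd hqd
  linarith

end Sum

end NoPocket

end Summit.Ventures.PercRepro2
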